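import Summits.BirchSwinnertonDyer.Rank1Residual.LW16.DescentReRouteShape
import Literature.NumberTheory.EllipticCurves.IsogenyFormulaCert
import Literature.NumberTheory.EllipticCurves.AnalyticRankOrderProofs
import Literature.NumberTheory.EllipticCurves.ComplexMultiplicationLFunctionIsogenyHoldsProofs
import HarnessLib

/-!
# LW16 re-route, record SHAPES on an ISOGENOUS member: `BSD(E,p)` on Cremona's curve 1 from ONE
# Ш-currency certificate line read on ANOTHER curve of the class, transported by Cassels along a
# kernel-checked isogeny certificate (the Ш-currency twin of the Selmer-currency transport)

HONEST FRAMING (programme BSD-LIT2PART v1 §T3, cell `pub/bsd-litref/lw16`, seat `bsd-litref-lw16-ty`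
«typer»; referee C4 ROUND C4-R1-ADD-13 (δ)(ii), 2026-08-27: «the (T3) transport road is sized two-blind +
desk at 77 closable cells and waits on the Ш-currency twin theorem (-ty, -pv) + per-pair
IsogenyCert/IsGloballyMinimal kernel certificates (precedent R198.24, 98190jIso)»). The RESISO lane's
per-pair records (`Resiso.bsdp<p>_resiso_<label>`, kernel `LW16.bsdp_rank{Zero,One}_of_ainvs_of_noPTorsionSha`
of `DescentReRouteShape.lean`) read the certificate line `hSha : Ш(E/ℚ)[p] = 0` on Cremona's CURVE 1 of
the class, together with `#Ш_an(curve 1) = q`, `ord_p q = 0`. On the (T3) cells curve 1 has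
`p ∣ #Ш_an` (no such record is possible there) while another member `E_k` of the SAME isogeny class is
`p`-unit with a two-method EXCESS-`0` descent; reader 1 (`lw16/sheets/r1-resiso/t3/CLOSABLE-T3-r1.txt`
6798cf2e) and reader 2 (`T3-NONCURVE1-r2.tsv` 2d775dbc) size this two-blind at 77 cells, all at `p = 3`.
This file fixes the SHAPE of such a record and proves it from the tree: `BSD(E_k,p)` by the class-free
Ш-currency consumer `Typed.bsdp_of_shaAn_unit_of_noPTorsion` (Gross–Zagier–Kolyvagin `hGZK` only), then
`BSD(curve 1,p)` by the isogeny invariance of `BSD(·,p)` (Cassels 1965 / Milne ADT I.7.3 as the named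
fact `hCassels : bsdRHS_eq_of_isIsogenous`; `Wuthrich2014.bsdp_of_isIsogenous`, with `Ш(E_k)` finite by
GZK and `L^{(r)}(E_k,1)/r! ≠ 0` by modularity `hmod`); the analytic rank is displayed on curve 1 (it is
an isogeny invariant unconditionally, `analyticRank_eq_of_isIsogenous'`, Knapp 11.67). The isogeny is
either a hypothesis (`…_of_isIsogenous`, §1–§2) or READ BY THE KERNEL from an explicit Vélu formula
(`PolyCert.IsogenyCert` with `check = true`, Silverman AEC III.4.8 / Rem. III.4.13.3; one certificate
for a `p`-isogenous member, two for a member at distance two in the isogeny graph, §3); both literal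
models must be GLOBALLY MINIMAL (the BSD quotient is taken on minimal models) — displayed hypotheses
`hmin`/`hmin'`, discharged per record by `X11b.isGloballyMinimal_of_krausCriterion_bounded₂` (`decide`).
It is the Ш-currency twin of the booked Selmer-currency transport
`Typed.bsdp_of_card_selmerGroup_le_pow_analyticRank_of_isIsogenous`; reader 1's non-proposed companion
`lw16/sheets/r1-resiso/t3/lean/ShaCurrencyTransportShape.lean` 187cc1ae (concurred by reader 2) is §1 in
instance form. Nothing here is new mathematics; this is not "finishing BSD"; per pair, never a class
theorem; NOTHING is booked by this file (the desk books). Theorems only (no definition, no named fact,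
no `sorry`); the named facts displayed (`hCassels`, `hGZK`, `hmod`) are the tree's published ones.

References: [MilneADT2006] Thm. I.7.3 and Remark I.7.4; [Cassels1965ArithmeticVIII]; [Miller2011LMS]
§1, Def. 1.1 («BSD(E,p) is an isogeny invariant»); [MillerStoll2013] §§6–7, Thm. 9.1; [SilvermanAEC2009]
Thm. III.4.8, Rem. III.4.13.3, VII.1 Rem. 1.1; [Knapp1993] Thm. 11.67; [Cremona1997] Table 1.
-/

noncomputable section

open scoped Classical

open WeierstrassCurve Literature.NumberTheory.EllipticCurves
  Literature.NumberTheory.EllipticCurves.Rank1Residual.Typed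
  Literature.NumberTheory.EllipticCurves.Rank1Residual.X11RankOneCertificates
  Literature.NumberTheory.EllipticCurves.PolyCert
  Summit.BirchSwinnertonDyer.Rank1Residual.X11b

namespace Summit.BirchSwinnertonDyer.Rank1Residual.LW16

/-! ### §1 Instance form: the Ш-currency twin of the Selmer-currency transport -/

/-- **Ш-currency transport shape.** For `ℚ`-isogenous globally minimal elliptic curves `W ∼ W'` with
`ord_{s=1} L(W,s) ≤ 1` (`hr`, displayed on `W`): if `#Ш_an(W') = q'` with `ord_p q' = 0` (`hq'`, `hv'`)
and `Ш(W'/ℚ)[p] = 0` (`hSha'`), then `BSD(W,p)`. Proof: `r_an(W') = r_an(W) ≤ 1` (Knapp 11.67, proved),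
`BSD(W',p)` by `Typed.bsdp_of_shaAn_unit_of_noPTorsion` (GZK `hGZK`), then Cassels' isogeny invariance
`Wuthrich2014.bsdp_of_isIsogenous` (`hCassels`; `Ш(W')` finite by GZK, `L^{(r)}(W',1)/r! ≠ 0` by
modularity `hmod`). [cite: MilneADT2006, Thm. I.7.3 and Remark I.7.4] [cite: Miller2011LMS, §1 and Def. 1.1] -/
theorem bsdp_of_noPTorsionSha_of_isIsogenous (hCassels : bsdRHS_eq_of_isIsogenous)
    (hGZK : rank_eq_analyticRank_of_analyticRank_le_one) (hmod : hasEntireLFunction_rat)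
    {W W' : WeierstrassCurve ℚ} [W.IsElliptic] [W.IsGloballyMinimal] [W'.IsElliptic]
    [W'.IsGloballyMinimal] (hiso : IsIsogenous W W') (p : ℕ) [Fact p.Prime]
    (hr : W.analyticRank ≤ 1) {q' : ℚ} (hq' : shaAn W' = (q' : ℂ)) (hv' : padicValRat p q' = 0)
    (hSha' : ∀ x : W'.sha, (p : ℤ) • x = 0 → x = 0) : BSDp W p := by
  have hr' : W'.analyticRank ≤ 1 := by rwa [← analyticRank_eq_of_isIsogenous' hiso]
  have h' : BSDp W' p := bsdp_of_shaAn_unit_of_noPTorsion W' p hGZK hr' hq' hv' hSha'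
  exact Wuthrich2014.bsdp_of_isIsogenous hCassels hiso (hGZK W' hr').2
    (WeierstrassCurve.leadingLCoeff_ne_zero_holds (hmod W')) h'

/-- **Both curves at once**: under the same reads on `W'`, `BSD(W,p) ∧ BSD(W',p)`.
[cite: MilneADT2006, Thm. I.7.3 and Remark I.7.4] [cite: Miller2011LMS, §1 and Def. 1.1] -/
theorem bsdp_and_bsdp_of_noPTorsionSha_of_isIsogenous (hCassels : bsdRHS_eq_of_isIsogenous)
    (hGZK : rank_eq_analyticRank_of_analyticRank_le_one) (hmod : hasEntireLFunction_rat)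
    {W W' : WeierstrassCurve ℚ} [W.IsElliptic] [W.IsGloballyMinimal] [W'.IsElliptic]
    [W'.IsGloballyMinimal] (hiso : IsIsogenous W W') (p : ℕ) [Fact p.Prime]
    (hr : W.analyticRank ≤ 1) {q' : ℚ} (hq' : shaAn W' = (q' : ℂ)) (hv' : padicValRat p q' = 0)
    (hSha' : ∀ x : W'.sha, (p : ℤ) • x = 0 → x = 0) : BSDp W p ∧ BSDp W' p := by
  have hr' : W'.analyticRank ≤ 1 := by rwa [← analyticRank_eq_of_isIsogenous' hiso]
  exact ⟨bsdp_of_noPTorsionSha_of_isIsogenous hCassels hGZK hmod hiso p hr hq' hv' hSha',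
    bsdp_of_shaAn_unit_of_noPTorsion W' p hGZK hr' hq' hv' hSha'⟩

/-! ### §2 Literal models, the isogeny as a hypothesis -/

/-- **Record shape (Ш-currency on an isogenous member), analytic rank `≤ 1`.** On the literal models
`W = [a₁,…,a₆]` (Cremona's curve 1) and `W' = [b₁,…,b₆]` (another curve of the class), both with `Δ ≠ 0`
(kernel-decided) and globally minimal (`hmin`, `hmin'`: Kraus–Silverman criterion, decided per record),
`ℚ`-isogenous (`hiso`): `BSD(W,p)` from GZK (`hGZK`), `r_an(W) ≤ 1` (`hr`), `#Ш_an(W') = q'` with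
`ord_p q' = 0` (`hq'`, `hv'`), the certificate `Ш(W'/ℚ)[p] = 0` (`hSha'`), Cassels (`hCassels`) and
modularity (`hmod`). [cite: MilneADT2006, Thm. I.7.3 and Remark I.7.4] [cite: Miller2011LMS, §1 and Def. 1.1]
[cite: MillerStoll2013, Thm. 9.1] -/
theorem bsdp_of_ainvs_of_noPTorsionSha_of_isIsogenous (hCassels : bsdRHS_eq_of_isIsogenous)
    (hGZK : rank_eq_analyticRank_of_analyticRank_le_one) (hmod : hasEntireLFunction_rat)
    (a1 a2 a3 a4 a6 b1 b2 b3 b4 b6 : ℤ) (p : ℕ) [Fact p.Prime]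
    (hΔ : discOf [a1, a2, a3, a4, a6] ≠ 0) (hΔ' : discOf [b1, b2, b3, b4, b6] ≠ 0)
    (hmin : (⟨a1, a2, a3, a4, a6⟩ : WeierstrassCurve ℚ).IsGloballyMinimal)
    (hmin' : (⟨b1, b2, b3, b4, b6⟩ : WeierstrassCurve ℚ).IsGloballyMinimal)
    (hiso : IsIsogenous (⟨a1, a2, a3, a4, a6⟩ : WeierstrassCurve ℚ) ⟨b1, b2, b3, b4, b6⟩)
    (hr : (⟨a1, a2, a3, a4, a6⟩ : WeierstrassCurve ℚ).analyticRank ≤ 1) {q' : ℚ}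
    (hq' : shaAn (⟨b1, b2, b3, b4, b6⟩ : WeierstrassCurve ℚ) = (q' : ℂ)) (hv' : padicValRat p q' = 0)
    (hSha' : ∀ x : (⟨b1, b2, b3, b4, b6⟩ : WeierstrassCurve ℚ).sha, (p : ℤ) • x = 0 → x = 0) :
    BSDp (⟨a1, a2, a3, a4, a6⟩ : WeierstrassCurve ℚ) p := by
  haveI := isElliptic_of_discOf_ne_zero a1 a2 a3 a4 a6 hΔ
  haveI := isElliptic_of_discOf_ne_zero b1 b2 b3 b4 b6 hΔ'
  haveI := hmin
  haveI := hmin'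
  exact bsdp_of_noPTorsionSha_of_isIsogenous hCassels hGZK hmod hiso p hr hq' hv' hSha'

/-- **Record shape (Ш-currency on an isogenous member), analytic rank `0`** displayed.
[cite: MilneADT2006, Thm. I.7.3 and Remark I.7.4] [cite: Miller2011LMS, §1 and Def. 1.1] -/
theorem bsdp_rankZero_of_ainvs_of_noPTorsionSha_of_isIsogenous (hCassels : bsdRHS_eq_of_isIsogenous)
    (hGZK : rank_eq_analyticRank_of_analyticRank_le_one) (hmod : hasEntireLFunction_rat)
    (a1 a2 a3 a4 a6 b1 b2 b3 b4 b6 : ℤ) (p : ℕ) [Fact p.Prime]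
    (hΔ : discOf [a1, a2, a3, a4, a6] ≠ 0) (hΔ' : discOf [b1, b2, b3, b4, b6] ≠ 0)
    (hmin : (⟨a1, a2, a3, a4, a6⟩ : WeierstrassCurve ℚ).IsGloballyMinimal)
    (hmin' : (⟨b1, b2, b3, b4, b6⟩ : WeierstrassCurve ℚ).IsGloballyMinimal)
    (hiso : IsIsogenous (⟨a1, a2, a3, a4, a6⟩ : WeierstrassCurve ℚ) ⟨b1, b2, b3, b4, b6⟩)
    (hr : (⟨a1, a2, a3, a4, a6⟩ : WeierstrassCurve ℚ).analyticRank = 0) {q' : ℚ}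
    (hq' : shaAn (⟨b1, b2, b3, b4, b6⟩ : WeierstrassCurve ℚ) = (q' : ℂ)) (hv' : padicValRat p q' = 0)
    (hSha' : ∀ x : (⟨b1, b2, b3, b4, b6⟩ : WeierstrassCurve ℚ).sha, (p : ℤ) • x = 0 → x = 0) :
    BSDp (⟨a1, a2, a3, a4, a6⟩ : WeierstrassCurve ℚ) p :=
  bsdp_of_ainvs_of_noPTorsionSha_of_isIsogenous hCassels hGZK hmod a1 a2 a3 a4 a6 b1 b2 b3 b4 b6 p
    hΔ hΔ' hmin hmin' hiso (by omega) hq' hv' hSha'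

/-- **Record shape (Ш-currency on an isogenous member), analytic rank `1`** displayed.
[cite: MilneADT2006, Thm. I.7.3 and Remark I.7.4] [cite: Miller2011LMS, §1 and Def. 1.1] -/
theorem bsdp_rankOne_of_ainvs_of_noPTorsionSha_of_isIsogenous (hCassels : bsdRHS_eq_of_isIsogenous)
    (hGZK : rank_eq_analyticRank_of_analyticRank_le_one) (hmod : hasEntireLFunction_rat)
    (a1 a2 a3 a4 a6 b1 b2 b3 b4 b6 : ℤ) (p : ℕ) [Fact p.Prime]
    (hΔ : discOf [a1, a2, a3, a4, a6] ≠ 0) (hΔ' : discOf [b1, b2, b3, b4, b6] ≠ 0)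
    (hmin : (⟨a1, a2, a3, a4, a6⟩ : WeierstrassCurve ℚ).IsGloballyMinimal)
    (hmin' : (⟨b1, b2, b3, b4, b6⟩ : WeierstrassCurve ℚ).IsGloballyMinimal)
    (hiso : IsIsogenous (⟨a1, a2, a3, a4, a6⟩ : WeierstrassCurve ℚ) ⟨b1, b2, b3, b4, b6⟩)
    (hr : (⟨a1, a2, a3, a4, a6⟩ : WeierstrassCurve ℚ).analyticRank = 1) {q' : ℚ}
    (hq' : shaAn (⟨b1, b2, b3, b4, b6⟩ : WeierstrassCurve ℚ) = (q' : ℂ)) (hv' : padicValRat p q' = 0)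
    (hSha' : ∀ x : (⟨b1, b2, b3, b4, b6⟩ : WeierstrassCurve ℚ).sha, (p : ℤ) • x = 0 → x = 0) :
    BSDp (⟨a1, a2, a3, a4, a6⟩ : WeierstrassCurve ℚ) p :=
  bsdp_of_ainvs_of_noPTorsionSha_of_isIsogenous hCassels hGZK hmod a1 a2 a3 a4 a6 b1 b2 b3 b4 b6 p
    hΔ hΔ' hmin hmin' hiso (by omega) hq' hv' hSha'

/-! ### §3 Literal models, the isogeny READ BY THE KERNEL from Vélu certificates -/

/-- **One certificate, either orientation.** Two literal models with `Δ ≠ 0` whose coefficients are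
the domain and codomain of a checked `IsogenyCert` (in either order) are `ℚ`-isogenous
(`IsogenyCert.isIsogenous`, Silverman AEC III.4.8; symmetry by the dual isogeny, III.6.1).
[cite: SilvermanAEC2009, Thm. III.4.8 and Remark III.4.13.3] -/
theorem isIsogenous_of_ainvs_of_isogenyCert (a1 a2 a3 a4 a6 b1 b2 b3 b4 b6 : ℤ)
    (hΔ : discOf [a1, a2, a3, a4, a6] ≠ 0) (hΔ' : discOf [b1, b2, b3, b4, b6] ≠ 0)
    (c : IsogenyCert) (hc : c.check = true)
    (hab : ((⟨a1, a2, a3, a4, a6⟩ : WeierstrassCurve ℚ) = ⟨c.a₁, c.a₂, c.a₃, c.a₄, c.a₆⟩ ∧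
        (⟨b1, b2, b3, b4, b6⟩ : WeierstrassCurve ℚ) = ⟨c.a₁', c.a₂', c.a₃', c.a₄', c.a₆'⟩) ∨
      ((⟨b1, b2, b3, b4, b6⟩ : WeierstrassCurve ℚ) = ⟨c.a₁, c.a₂, c.a₃, c.a₄, c.a₆⟩ ∧
        (⟨a1, a2, a3, a4, a6⟩ : WeierstrassCurve ℚ) = ⟨c.a₁', c.a₂', c.a₃', c.a₄', c.a₆'⟩)) :
    IsIsogenous (⟨a1, a2, a3, a4, a6⟩ : WeierstrassCurve ℚ) ⟨b1, b2, b3, b4, b6⟩ := by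
  haveI := isElliptic_of_discOf_ne_zero a1 a2 a3 a4 a6 hΔ
  haveI := isElliptic_of_discOf_ne_zero b1 b2 b3 b4 b6 hΔ'
  rcases hab with ⟨ha, hb⟩ | ⟨hb, ha⟩
  · exact IsogenyCert.isIsogenous c hc ha hb
  · exact (IsogenyCert.isIsogenous c hc hb ha).symm_of_charZero

/-- **Record shape with ONE kernel-checked isogeny certificate** (a `p`-isogenous member — or any
member one certified isogeny away from curve 1), analytic rank `≤ 1`: as
`bsdp_of_ainvs_of_noPTorsionSha_of_isIsogenous`, the isogeny supplied by a checked `IsogenyCert` whose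
(domain, codomain) is (curve 1, member) or (member, curve 1) (`hab`, by `rfl` per record; `hc` by
`decide +kernel`). [cite: SilvermanAEC2009, Thm. III.4.8 and Remark III.4.13.3]
[cite: MilneADT2006, Thm. I.7.3 and Remark I.7.4] [cite: Miller2011LMS, §1 and Def. 1.1] -/
theorem bsdp_of_ainvs_of_noPTorsionSha_of_isogenyCert (hCassels : bsdRHS_eq_of_isIsogenous)
    (hGZK : rank_eq_analyticRank_of_analyticRank_le_one) (hmod : hasEntireLFunction_rat)
    (a1 a2 a3 a4 a6 b1 b2 b3 b4 b6 : ℤ) (p : ℕ) [Fact p.Prime]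
    (hΔ : discOf [a1, a2, a3, a4, a6] ≠ 0) (hΔ' : discOf [b1, b2, b3, b4, b6] ≠ 0)
    (hmin : (⟨a1, a2, a3, a4, a6⟩ : WeierstrassCurve ℚ).IsGloballyMinimal)
    (hmin' : (⟨b1, b2, b3, b4, b6⟩ : WeierstrassCurve ℚ).IsGloballyMinimal)
    (c : IsogenyCert) (hc : c.check = true)
    (hab : ((⟨a1, a2, a3, a4, a6⟩ : WeierstrassCurve ℚ) = ⟨c.a₁, c.a₂, c.a₃, c.a₄, c.a₆⟩ ∧
        (⟨b1, b2, b3, b4, b6⟩ : WeierstrassCurve ℚ) = ⟨c.a₁', c.a₂', c.a₃', c.a₄', c.a₆'⟩) ∨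
      ((⟨b1, b2, b3, b4, b6⟩ : WeierstrassCurve ℚ) = ⟨c.a₁, c.a₂, c.a₃, c.a₄, c.a₆⟩ ∧
        (⟨a1, a2, a3, a4, a6⟩ : WeierstrassCurve ℚ) = ⟨c.a₁', c.a₂', c.a₃', c.a₄', c.a₆'⟩))
    (hr : (⟨a1, a2, a3, a4, a6⟩ : WeierstrassCurve ℚ).analyticRank ≤ 1) {q' : ℚ}
    (hq' : shaAn (⟨b1, b2, b3, b4, b6⟩ : WeierstrassCurve ℚ) = (q' : ℂ)) (hv' : padicValRat p q' = 0)
    (hSha' : ∀ x : (⟨b1, b2, b3, b4, b6⟩ : WeierstrassCurve ℚ).sha, (p : ℤ) • x = 0 → x = 0) :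
    BSDp (⟨a1, a2, a3, a4, a6⟩ : WeierstrassCurve ℚ) p :=
  bsdp_of_ainvs_of_noPTorsionSha_of_isIsogenous hCassels hGZK hmod a1 a2 a3 a4 a6 b1 b2 b3 b4 b6 p
    hΔ hΔ' hmin hmin' (isIsogenous_of_ainvs_of_isogenyCert a1 a2 a3 a4 a6 b1 b2 b3 b4 b6 hΔ hΔ' c hc hab)
    hr hq' hv' hSha'

/-- **One certificate, analytic rank `0`** displayed. [cite: SilvermanAEC2009, Thm. III.4.8]
[cite: MilneADT2006, Thm. I.7.3 and Remark I.7.4] [cite: Miller2011LMS, §1 and Def. 1.1] -/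
theorem bsdp_rankZero_of_ainvs_of_noPTorsionSha_of_isogenyCert (hCassels : bsdRHS_eq_of_isIsogenous)
    (hGZK : rank_eq_analyticRank_of_analyticRank_le_one) (hmod : hasEntireLFunction_rat)
    (a1 a2 a3 a4 a6 b1 b2 b3 b4 b6 : ℤ) (p : ℕ) [Fact p.Prime]
    (hΔ : discOf [a1, a2, a3, a4, a6] ≠ 0) (hΔ' : discOf [b1, b2, b3, b4, b6] ≠ 0)
    (hmin : (⟨a1, a2, a3, a4, a6⟩ : WeierstrassCurve ℚ).IsGloballyMinimal)
    (hmin' : (⟨b1, b2, b3, b4, b6⟩ : WeierstrassCurve ℚ).IsGloballyMinimal)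
    (c : IsogenyCert) (hc : c.check = true)
    (hab : ((⟨a1, a2, a3, a4, a6⟩ : WeierstrassCurve ℚ) = ⟨c.a₁, c.a₂, c.a₃, c.a₄, c.a₆⟩ ∧
        (⟨b1, b2, b3, b4, b6⟩ : WeierstrassCurve ℚ) = ⟨c.a₁', c.a₂', c.a₃', c.a₄', c.a₆'⟩) ∨
      ((⟨b1, b2, b3, b4, b6⟩ : WeierstrassCurve ℚ) = ⟨c.a₁, c.a₂, c.a₃, c.a₄, c.a₆⟩ ∧
        (⟨a1, a2, a3, a4, a6⟩ : WeierstrassCurve ℚ) = ⟨c.a₁', c.a₂', c.a₃', c.a₄', c.a₆'⟩))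
    (hr : (⟨a1, a2, a3, a4, a6⟩ : WeierstrassCurve ℚ).analyticRank = 0) {q' : ℚ}
    (hq' : shaAn (⟨b1, b2, b3, b4, b6⟩ : WeierstrassCurve ℚ) = (q' : ℂ)) (hv' : padicValRat p q' = 0)
    (hSha' : ∀ x : (⟨b1, b2, b3, b4, b6⟩ : WeierstrassCurve ℚ).sha, (p : ℤ) • x = 0 → x = 0) :
    BSDp (⟨a1, a2, a3, a4, a6⟩ : WeierstrassCurve ℚ) p :=
  bsdp_of_ainvs_of_noPTorsionSha_of_isogenyCert hCassels hGZK hmod a1 a2 a3 a4 a6 b1 b2 b3 b4 b6 p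
    hΔ hΔ' hmin hmin' c hc hab (by omega) hq' hv' hSha'

/-- **One certificate, analytic rank `1`** displayed. [cite: SilvermanAEC2009, Thm. III.4.8]
[cite: MilneADT2006, Thm. I.7.3 and Remark I.7.4] [cite: Miller2011LMS, §1 and Def. 1.1] -/
theorem bsdp_rankOne_of_ainvs_of_noPTorsionSha_of_isogenyCert (hCassels : bsdRHS_eq_of_isIsogenous)
    (hGZK : rank_eq_analyticRank_of_analyticRank_le_one) (hmod : hasEntireLFunction_rat)
    (a1 a2 a3 a4 a6 b1 b2 b3 b4 b6 : ℤ) (p : ℕ) [Fact p.Prime]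
    (hΔ : discOf [a1, a2, a3, a4, a6] ≠ 0) (hΔ' : discOf [b1, b2, b3, b4, b6] ≠ 0)
    (hmin : (⟨a1, a2, a3, a4, a6⟩ : WeierstrassCurve ℚ).IsGloballyMinimal)
    (hmin' : (⟨b1, b2, b3, b4, b6⟩ : WeierstrassCurve ℚ).IsGloballyMinimal)
    (c : IsogenyCert) (hc : c.check = true)
    (hab : ((⟨a1, a2, a3, a4, a6⟩ : WeierstrassCurve ℚ) = ⟨c.a₁, c.a₂, c.a₃, c.a₄, c.a₆⟩ ∧
        (⟨b1, b2, b3, b4, b6⟩ : WeierstrassCurve ℚ) = ⟨c.a₁', c.a₂', c.a₃', c.a₄', c.a₆'⟩) ∨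
      ((⟨b1, b2, b3, b4, b6⟩ : WeierstrassCurve ℚ) = ⟨c.a₁, c.a₂, c.a₃, c.a₄, c.a₆⟩ ∧
        (⟨a1, a2, a3, a4, a6⟩ : WeierstrassCurve ℚ) = ⟨c.a₁', c.a₂', c.a₃', c.a₄', c.a₆'⟩))
    (hr : (⟨a1, a2, a3, a4, a6⟩ : WeierstrassCurve ℚ).analyticRank = 1) {q' : ℚ}
    (hq' : shaAn (⟨b1, b2, b3, b4, b6⟩ : WeierstrassCurve ℚ) = (q' : ℂ)) (hv' : padicValRat p q' = 0)
    (hSha' : ∀ x : (⟨b1, b2, b3, b4, b6⟩ : WeierstrassCurve ℚ).sha, (p : ℤ) • x = 0 → x = 0) :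
    BSDp (⟨a1, a2, a3, a4, a6⟩ : WeierstrassCurve ℚ) p :=
  bsdp_of_ainvs_of_noPTorsionSha_of_isogenyCert hCassels hGZK hmod a1 a2 a3 a4 a6 b1 b2 b3 b4 b6 p
    hΔ hΔ' hmin hmin' c hc hab (by omega) hq' hv' hSha'

/-- **Two certificates through an intermediate member** (a member at distance two in the isogeny
graph, e.g. degree `p²` from curve 1): literal models `W = [a]` (curve 1), `M = [m]` (intermediate,
`Δ ≠ 0`), `W' = [b]` (the certified member); certificates `c₁` between `W` and `M` and `c₂` between `M`
and `W'`, each in either orientation; transitivity `IsIsogenous.trans'`. Analytic rank `≤ 1`.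
[cite: SilvermanAEC2009, Thm. III.4.8 and Remark III.4.13.3] [cite: MilneADT2006, Thm. I.7.3 and Remark I.7.4]
[cite: Miller2011LMS, §1 and Def. 1.1] -/
theorem bsdp_of_ainvs_of_noPTorsionSha_of_isogenyCert₂ (hCassels : bsdRHS_eq_of_isIsogenous)
    (hGZK : rank_eq_analyticRank_of_analyticRank_le_one) (hmod : hasEntireLFunction_rat)
    (a1 a2 a3 a4 a6 m1 m2 m3 m4 m6 b1 b2 b3 b4 b6 : ℤ) (p : ℕ) [Fact p.Prime]
    (hΔ : discOf [a1, a2, a3, a4, a6] ≠ 0) (hΔm : discOf [m1, m2, m3, m4, m6] ≠ 0)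
    (hΔ' : discOf [b1, b2, b3, b4, b6] ≠ 0)
    (hmin : (⟨a1, a2, a3, a4, a6⟩ : WeierstrassCurve ℚ).IsGloballyMinimal)
    (hmin' : (⟨b1, b2, b3, b4, b6⟩ : WeierstrassCurve ℚ).IsGloballyMinimal)
    (c₁ : IsogenyCert) (hc₁ : c₁.check = true)
    (ham : ((⟨a1, a2, a3, a4, a6⟩ : WeierstrassCurve ℚ) = ⟨c₁.a₁, c₁.a₂, c₁.a₃, c₁.a₄, c₁.a₆⟩ ∧
        (⟨m1, m2, m3, m4, m6⟩ : WeierstrassCurve ℚ) = ⟨c₁.a₁', c₁.a₂', c₁.a₃', c₁.a₄', c₁.a₆'⟩) ∨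
      ((⟨m1, m2, m3, m4, m6⟩ : WeierstrassCurve ℚ) = ⟨c₁.a₁, c₁.a₂, c₁.a₃, c₁.a₄, c₁.a₆⟩ ∧
        (⟨a1, a2, a3, a4, a6⟩ : WeierstrassCurve ℚ) = ⟨c₁.a₁', c₁.a₂', c₁.a₃', c₁.a₄', c₁.a₆'⟩))
    (c₂ : IsogenyCert) (hc₂ : c₂.check = true)
    (hmb : ((⟨m1, m2, m3, m4, m6⟩ : WeierstrassCurve ℚ) = ⟨c₂.a₁, c₂.a₂, c₂.a₃, c₂.a₄, c₂.a₆⟩ ∧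
        (⟨b1, b2, b3, b4, b6⟩ : WeierstrassCurve ℚ) = ⟨c₂.a₁', c₂.a₂', c₂.a₃', c₂.a₄', c₂.a₆'⟩) ∨
      ((⟨b1, b2, b3, b4, b6⟩ : WeierstrassCurve ℚ) = ⟨c₂.a₁, c₂.a₂, c₂.a₃, c₂.a₄, c₂.a₆⟩ ∧
        (⟨m1, m2, m3, m4, m6⟩ : WeierstrassCurve ℚ) = ⟨c₂.a₁', c₂.a₂', c₂.a₃', c₂.a₄', c₂.a₆'⟩))
    (hr : (⟨a1, a2, a3, a4, a6⟩ : WeierstrassCurve ℚ).analyticRank ≤ 1) {q' : ℚ}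
    (hq' : shaAn (⟨b1, b2, b3, b4, b6⟩ : WeierstrassCurve ℚ) = (q' : ℂ)) (hv' : padicValRat p q' = 0)
    (hSha' : ∀ x : (⟨b1, b2, b3, b4, b6⟩ : WeierstrassCurve ℚ).sha, (p : ℤ) • x = 0 → x = 0) :
    BSDp (⟨a1, a2, a3, a4, a6⟩ : WeierstrassCurve ℚ) p :=
  bsdp_of_ainvs_of_noPTorsionSha_of_isIsogenous hCassels hGZK hmod a1 a2 a3 a4 a6 b1 b2 b3 b4 b6 p
    hΔ hΔ' hmin hmin'
    ((isIsogenous_of_ainvs_of_isogenyCert a1 a2 a3 a4 a6 m1 m2 m3 m4 m6 hΔ hΔm c₁ hc₁ ham).trans'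
      (isIsogenous_of_ainvs_of_isogenyCert m1 m2 m3 m4 m6 b1 b2 b3 b4 b6 hΔm hΔ' c₂ hc₂ hmb))
    hr hq' hv' hSha'

/-- **Two certificates, analytic rank `0`** displayed. [cite: SilvermanAEC2009, Thm. III.4.8]
[cite: MilneADT2006, Thm. I.7.3 and Remark I.7.4] [cite: Miller2011LMS, §1 and Def. 1.1] -/
theorem bsdp_rankZero_of_ainvs_of_noPTorsionSha_of_isogenyCert₂ (hCassels : bsdRHS_eq_of_isIsogenous)
    (hGZK : rank_eq_analyticRank_of_analyticRank_le_one) (hmod : hasEntireLFunction_rat)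
    (a1 a2 a3 a4 a6 m1 m2 m3 m4 m6 b1 b2 b3 b4 b6 : ℤ) (p : ℕ) [Fact p.Prime]
    (hΔ : discOf [a1, a2, a3, a4, a6] ≠ 0) (hΔm : discOf [m1, m2, m3, m4, m6] ≠ 0)
    (hΔ' : discOf [b1, b2, b3, b4, b6] ≠ 0)
    (hmin : (⟨a1, a2, a3, a4, a6⟩ : WeierstrassCurve ℚ).IsGloballyMinimal)
    (hmin' : (⟨b1, b2, b3, b4, b6⟩ : WeierstrassCurve ℚ).IsGloballyMinimal)
    (c₁ : IsogenyCert) (hc₁ : c₁.check = true)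
    (ham : ((⟨a1, a2, a3, a4, a6⟩ : WeierstrassCurve ℚ) = ⟨c₁.a₁, c₁.a₂, c₁.a₃, c₁.a₄, c₁.a₆⟩ ∧
        (⟨m1, m2, m3, m4, m6⟩ : WeierstrassCurve ℚ) = ⟨c₁.a₁', c₁.a₂', c₁.a₃', c₁.a₄', c₁.a₆'⟩) ∨
      ((⟨m1, m2, m3, m4, m6⟩ : WeierstrassCurve ℚ) = ⟨c₁.a₁, c₁.a₂, c₁.a₃, c₁.a₄, c₁.a₆⟩ ∧
        (⟨a1, a2, a3, a4, a6⟩ : WeierstrassCurve ℚ) = ⟨c₁.a₁', c₁.a₂', c₁.a₃', c₁.a₄', c₁.a₆'⟩))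
    (c₂ : IsogenyCert) (hc₂ : c₂.check = true)
    (hmb : ((⟨m1, m2, m3, m4, m6⟩ : WeierstrassCurve ℚ) = ⟨c₂.a₁, c₂.a₂, c₂.a₃, c₂.a₄, c₂.a₆⟩ ∧
        (⟨b1, b2, b3, b4, b6⟩ : WeierstrassCurve ℚ) = ⟨c₂.a₁', c₂.a₂', c₂.a₃', c₂.a₄', c₂.a₆'⟩) ∨
      ((⟨b1, b2, b3, b4, b6⟩ : WeierstrassCurve ℚ) = ⟨c₂.a₁, c₂.a₂, c₂.a₃, c₂.a₄, c₂.a₆⟩ ∧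
        (⟨m1, m2, m3, m4, m6⟩ : WeierstrassCurve ℚ) = ⟨c₂.a₁', c₂.a₂', c₂.a₃', c₂.a₄', c₂.a₆'⟩))
    (hr : (⟨a1, a2, a3, a4, a6⟩ : WeierstrassCurve ℚ).analyticRank = 0) {q' : ℚ}
    (hq' : shaAn (⟨b1, b2, b3, b4, b6⟩ : WeierstrassCurve ℚ) = (q' : ℂ)) (hv' : padicValRat p q' = 0)
    (hSha' : ∀ x : (⟨b1, b2, b3, b4, b6⟩ : WeierstrassCurve ℚ).sha, (p : ℤ) • x = 0 → x = 0) :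
    BSDp (⟨a1, a2, a3, a4, a6⟩ : WeierstrassCurve ℚ) p :=
  bsdp_of_ainvs_of_noPTorsionSha_of_isogenyCert₂ hCassels hGZK hmod a1 a2 a3 a4 a6 m1 m2 m3 m4 m6
    b1 b2 b3 b4 b6 p hΔ hΔm hΔ' hmin hmin' c₁ hc₁ ham c₂ hc₂ hmb (by omega) hq' hv' hSha'

/-- **Two certificates, analytic rank `1`** displayed. [cite: SilvermanAEC2009, Thm. III.4.8]
[cite: MilneADT2006, Thm. I.7.3 and Remark I.7.4] [cite: Miller2011LMS, §1 and Def. 1.1] -/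
theorem bsdp_rankOne_of_ainvs_of_noPTorsionSha_of_isogenyCert₂ (hCassels : bsdRHS_eq_of_isIsogenous)
    (hGZK : rank_eq_analyticRank_of_analyticRank_le_one) (hmod : hasEntireLFunction_rat)
    (a1 a2 a3 a4 a6 m1 m2 m3 m4 m6 b1 b2 b3 b4 b6 : ℤ) (p : ℕ) [Fact p.Prime]
    (hΔ : discOf [a1, a2, a3, a4, a6] ≠ 0) (hΔm : discOf [m1, m2, m3, m4, m6] ≠ 0)
    (hΔ' : discOf [b1, b2, b3, b4, b6] ≠ 0)
    (hmin : (⟨a1, a2, a3, a4, a6⟩ : WeierstrassCurve ℚ).IsGloballyMinimal)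
    (hmin' : (⟨b1, b2, b3, b4, b6⟩ : WeierstrassCurve ℚ).IsGloballyMinimal)
    (c₁ : IsogenyCert) (hc₁ : c₁.check = true)
    (ham : ((⟨a1, a2, a3, a4, a6⟩ : WeierstrassCurve ℚ) = ⟨c₁.a₁, c₁.a₂, c₁.a₃, c₁.a₄, c₁.a₆⟩ ∧
        (⟨m1, m2, m3, m4, m6⟩ : WeierstrassCurve ℚ) = ⟨c₁.a₁', c₁.a₂', c₁.a₃', c₁.a₄', c₁.a₆'⟩) ∨
      ((⟨m1, m2, m3, m4, m6⟩ : WeierstrassCurve ℚ) = ⟨c₁.a₁, c₁.a₂, c₁.a₃, c₁.a₄, c₁.a₆⟩ ∧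
        (⟨a1, a2, a3, a4, a6⟩ : WeierstrassCurve ℚ) = ⟨c₁.a₁', c₁.a₂', c₁.a₃', c₁.a₄', c₁.a₆'⟩))
    (c₂ : IsogenyCert) (hc₂ : c₂.check = true)
    (hmb : ((⟨m1, m2, m3, m4, m6⟩ : WeierstrassCurve ℚ) = ⟨c₂.a₁, c₂.a₂, c₂.a₃, c₂.a₄, c₂.a₆⟩ ∧
        (⟨b1, b2, b3, b4, b6⟩ : WeierstrassCurve ℚ) = ⟨c₂.a₁', c₂.a₂', c₂.a₃', c₂.a₄', c₂.a₆'⟩) ∨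
      ((⟨b1, b2, b3, b4, b6⟩ : WeierstrassCurve ℚ) = ⟨c₂.a₁, c₂.a₂, c₂.a₃, c₂.a₄, c₂.a₆⟩ ∧
        (⟨m1, m2, m3, m4, m6⟩ : WeierstrassCurve ℚ) = ⟨c₂.a₁', c₂.a₂', c₂.a₃', c₂.a₄', c₂.a₆'⟩))
    (hr : (⟨a1, a2, a3, a4, a6⟩ : WeierstrassCurve ℚ).analyticRank = 1) {q' : ℚ}
    (hq' : shaAn (⟨b1, b2, b3, b4, b6⟩ : WeierstrassCurve ℚ) = (q' : ℂ)) (hv' : padicValRat p q' = 0)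
    (hSha' : ∀ x : (⟨b1, b2, b3, b4, b6⟩ : WeierstrassCurve ℚ).sha, (p : ℤ) • x = 0 → x = 0) :
    BSDp (⟨a1, a2, a3, a4, a6⟩ : WeierstrassCurve ℚ) p :=
  bsdp_of_ainvs_of_noPTorsionSha_of_isogenyCert₂ hCassels hGZK hmod a1 a2 a3 a4 a6 m1 m2 m3 m4 m6
    b1 b2 b3 b4 b6 p hΔ hΔm hΔ' hmin hmin' c₁ hc₁ ham c₂ hc₂ hmb (by omega) hq' hv' hSha'

end Summit.BirchSwinnertonDyer.Rank1Residual.LW16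

end
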